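import Summits.CriticalPhenomena.PercolationContinuityZ3.Theorems.PercNearOneGluingNoHeavyLowerTailCILStarTransferTools
import Literature.Probability.Percolation.LonelyClusterExchange
import HarnessLib

/-!
# `NoHeavyLowerTail` (stmt-CriticalPhenomena-4575) — CIL at a general observer from set-champion stability in `G − o`

Support file (prover `prim-gen-induct`, blob-quotient / cumulative-isolation line; `--supports
stmt-CriticalPhenomena-4575`).  No definitions, no named facts, no sorries.

Notation: `μ = prodBernoulli w` on `Fin n`, relays `A`, observer `o ∉ A`, level `j`, `π(v) = {x ∈ A : v ↔ x}`,
`N = |π(o)|`, `L = {1 ≤ N ≤ j}`, `R_q = {|π(q)| ≤ j}`; CIL_j is `∃ a ∈ A, μ(L) ≤ μ(R_a)` (registered stub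
`stub_cumulativeIsolation`, which closes the crux by `Theorems.noHeavyLowerTail_of_stub_cumulativeIsolation`).
`H`-reachability `x ~' y` means an open path using no edge at `o` (configuration `ω ∩ {e | o ∉ e}`, i.e. the
graph `G − o`), `π'(v)`, `π'(B) = ⋃_{y ∈ B} π'(y)` the relays `H`-joined to `v` / to some vertex of `B`, and
`s(y) = μ{|π'(y)| ≤ j}` the `H`-LIGHTNESS of a vertex.

THE STAR TRANSFER.  Decompose by the star `σ_B` of `o` (the set `B` of neighbours joined to `o` by an open
edge; Kozma–Nitzan's `σ_B`, `Literature.….starEvent`).  On `σ_B` one has `π(o) = π'(B)`, and for a vertex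
`q`: either `q ~' B` (then `π(q) = π(o)` and `L ⊆ R_q`) or `q ≁' B` (then `π(q) = π'(q)`).  Since `σ_B` is
independent of the configuration off `o`, for EVERY vertex `q ≠ o`

  `μ(L) ≤ μ(R_q)`  whenever, for every star `B` of positive mass,
  `CS(B, q) :  μ(q ≁' B, 1 ≤ |π'(B)| ≤ j) ≤ μ(q ≁' B, |π'(q)| ≤ j)`            (set-champion stability in `G − o`).

`CS(B, q)` is AUTOMATIC when `B` contains a vertex `y` at least as `H`-light-unlikely as `q`, `s(y) ≤ s(q)` — a
relay when `q` is the `H`-champion, or a "heavy" Steiner vertex — by the lonely-cluster exchange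
(`Literature.….observerSet_le_of_lonelier`, van den Berg–Häggström–Kahn Thm 1.5).  The per-star lemma
`CutObserver.star_transfer` and the star bookkeeping are in `…CILStarTransferTools`.  Hence:

* `cil_of_starStability` — **CIL_j at `o` with the witness `q` (the `H`-champion) follows from `CS(B, q)` for the
  stars `B` made ENTIRELY of LIGHT non-relay neighbours of `o` (`s(y) > s(q)` for all `y ∈ B`).**  With no light
  Steiner neighbour this is the landed relay-neighbour / heavy-Steiner theorems
  (`Theorems.cil_relayNeighbours`, `Theorems.cumulativeIsolation_of_isolatedObserver`,
  `Theorems.cumulativeIsolation_of_heavySteinerNeighbours`); in general it is a POINTWISE reduction of CIL at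
  `o` to finitely many instances, in the smaller graph `G − o`, of the set-observer champion-stability
  inequality (the sibling line's conjecture CS / registered `stub_championStabilityPair` is its two-point case).
* `cil_of_oneLightSteinerNeighbour`, `cumulativeIsolation_of_oneLightSteinerNeighbour` — **if `o` has exactly
  ONE light non-relay neighbour `v` (any number of relay and heavy neighbours, arbitrary graph elsewhere), then
  CIL_j for the observer `v` in `G − o` implies CIL_j for `o` in `G`** (the only star to check is `B = {v}`, and
  `CS({v}, q)` is CIL at `v` by the two-cluster identity `μ(q ~' v, 1 ≤ |π'(v)| ≤ j) = μ(q ~' v, |π'(q)| ≤ j)`,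
  `q ∈ A`).  This is the cumulative-isolation analogue of Kozma–Nitzan's Theorem 5 (arXiv:2401.12397 §3.2,
  one private extra vertex), without the privacy assumption on `v`.

Numerically (sibling census MERGE-STABILITY.md, exact, p = ½ exhaustive |B| ≤ 3 and weighted): CS has no known
counterexample; it is the common kernel on which the blob-quotient line (this file: star transfer) and the
deletion–contraction line (merge stability) meet.
-/

noncomputable section

namespace Summit.CriticalPhenomena.PercolationContinuityZ3.Theorems

open MeasureTheory Set Literature.Probability.LatticeModels Literature.Probability.Percolation
open scoped Classical BigOperators

variable {n : ℕ}
open CutObserver KNPreFKG in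
/-- **CIL at a general observer from set-champion stability in `G − o` (star transfer).**  Let `o ∉ A`,
`q ≠ o` any vertex, and write `x ~' y` for an open path avoiding `o`, `π'(y)` for the relays so joined to `y`,
`s(y) = μ{|π'(y)| ≤ j}`.  Assume `hCS`: for every nonempty finite set `B` of positive-weight neighbours of `o` that
are all LIGHTER than `q` (`y ≠ o`, `w s(o,y) ≠ 0`, `s(q) < s(y)` for all `y ∈ B`) the set-champion stability
inequality `μ(q ≁' B, 1 ≤ |π'(B)| ≤ j) ≤ μ(q ≁' B, |π'(q)| ≤ j)` holds (`π'(B)` = relays `~'`-joined to some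
`y ∈ B`).  Then `μ{1 ≤ N ≤ j} ≤ μ{|π(q)| ≤ j}` — for `q ∈ A` the conclusion of `stub_cumulativeIsolation` (crux
`NoHeavyLowerTail`, stmt-CriticalPhenomena-4575) with the witness `q`; when `q` is an `H`-champion of `A`
(`s(a) ≤ s(q)` for all relays `a`) the light stars consist of non-relays.  Proof: sum the star transfer
`CutObserver.star_transfer`
over the stars `σ_B` of `o` (`Literature.….KNPreFKG.real_eq_sum_inter_starEvent`); a star containing a vertex
`y` with `s(y) ≤ s(q)` satisfies the stability inequality by the lonely-cluster exchange
`Literature.….observerSet_le_of_lonelier` (BHK 2006 Thm 1.5), transferred to the configuration off `o` by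
`CutObserver.measureReal_preimage_avoid`; the empty star carries no mass of `{1 ≤ N}`.
[cite: VandenbergHaggstromKahn2005, Thm. 1.5 (p. 7); KozmaNitzan2024, Lemma 5 and Thm. 4 (pp. 13–14) — star decomposition] -/
theorem cil_of_starStability (w : Sym2 (Fin n) → unitInterval) (A : Finset (Fin n)) (o q : Fin n) (j : ℕ)
    (hoA : o ∉ A) (hqo : q ≠ o)
    (hCS : ∀ B : Finset (Fin n), B.Nonempty →
      (∀ y ∈ B, y ≠ o ∧ w s(o, y) ≠ 0 ∧
        (prodBernoulli w).real {ω : BondConfig (Fin n) |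
            (A.filter fun z => (openGraph (ω ∩ {e | o ∉ e})).Reachable q z).card ≤ j} <
          (prodBernoulli w).real {ω : BondConfig (Fin n) |
            (A.filter fun z => (openGraph (ω ∩ {e | o ∉ e})).Reachable y z).card ≤ j}) →
      (prodBernoulli w).real {ω : BondConfig (Fin n) |
          (∀ y ∈ B, ¬ (openGraph (ω ∩ {e | o ∉ e})).Reachable q y) ∧
            1 ≤ (A.filter fun z => ∃ y ∈ B, (openGraph (ω ∩ {e | o ∉ e})).Reachable y z).card ∧
            (A.filter fun z => ∃ y ∈ B, (openGraph (ω ∩ {e | o ∉ e})).Reachable y z).card ≤ j} ≤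
        (prodBernoulli w).real {ω : BondConfig (Fin n) |
          (∀ y ∈ B, ¬ (openGraph (ω ∩ {e | o ∉ e})).Reachable q y) ∧
            (A.filter fun z => (openGraph (ω ∩ {e | o ∉ e})).Reachable q z).card ≤ j}) :
    (prodBernoulli w).real {ω : BondConfig (Fin n) |
        1 ≤ (A.filter fun x => ω ∈ openConn o x).card ∧ (A.filter fun x => ω ∈ openConn o x).card ≤ j} ≤
      (prodBernoulli w).real {ω : BondConfig (Fin n) | (A.filter fun x => ω ∈ openConn q x).card ≤ j} := by
  haveI : IsProbabilityMeasure (prodBernoulli w) := inferInstance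
  set μ := prodBernoulli w with hμ
  set L := {ω : BondConfig (Fin n) |
    1 ≤ (A.filter fun x => ω ∈ openConn o x).card ∧ (A.filter fun x => ω ∈ openConn o x).card ≤ j} with hL
  set Rq := {ω : BondConfig (Fin n) | (A.filter fun x => ω ∈ openConn q x).card ≤ j} with hRq
  -- the `H`-lightness of a vertex
  set sW : Fin n → ℝ := fun y => μ.real {ω : BondConfig (Fin n) |
    (A.filter fun z => (openGraph (ω ∩ {e | o ∉ e})).Reachable y z).card ≤ j} with hsW
  -- positive-weight neighbours of `o`
  set Γ : Finset (Fin n) := Finset.univ.filter fun v => v ≠ o ∧ w s(o, v) ≠ 0 with hΓ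
  have hΓo : o ∉ Γ := by
    rw [hΓ, Finset.mem_filter]; exact fun h => h.2.1 rfl
  have hiso : ∀ v, v ≠ o → v ∉ Γ → w s(o, v) = 0 := by
    intro v hvo hvΓ
    by_contra hne
    exact hvΓ (Finset.mem_filter.2 ⟨Finset.mem_univ _, hvo, hne⟩)
  rw [real_eq_sum_inter_starEvent w Γ o hΓo hiso L, real_eq_sum_inter_starEvent w Γ o hΓo hiso Rq]
  refine Finset.sum_le_sum fun B hB => ?_
  have hBΓ : B ⊆ Γ := Finset.mem_powerset.1 hB
  have hBo : ∀ y ∈ B, y ≠ o := fun y hy => (Finset.mem_filter.1 (hBΓ hy)).2.1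
  rcases B.eq_empty_or_nonempty with rfl | hBne
  · -- the empty star: `o` is isolated, `N = 0`
    have h0 : L ∩ starEvent o ↑(∅ : Finset (Fin n)) = (∅ : Set (BondConfig (Fin n))) := by
      ext ω
      simp only [mem_inter_iff, mem_empty_iff_false, iff_false, not_and]
      intro hLω hσ
      rw [Finset.coe_empty] at hσ
      obtain ⟨x, hx⟩ := Finset.card_pos.1 (lt_of_lt_of_le Nat.zero_lt_one hLω.1)
      rw [Finset.mem_filter] at hx
      exact not_reachable_of_mem_starEvent_empty hσ (fun h => hoA (h ▸ hx.1)) hx.2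
    rw [h0, measureReal_empty]
    exact measureReal_nonneg
  · refine star_transfer w A o q j hoA hqo B hBo ?_
    -- the set-champion stability inequality for the star `B`
    by_cases hheavy : ∃ y ∈ B, sW y ≤ sW q
    · -- a member at least as heavy as `q`: lonely-cluster exchange in the graph without the edges at `o`
      obtain ⟨y, hyB, hy⟩ := hheavy
      have e1 : ∀ x : Fin n, {ω : BondConfig (Fin n) |
            (A.filter fun z => (openGraph (ω ∩ {e | o ∉ e})).Reachable x z).card ≤ j} =
          {ω : BondConfig (Fin n) | ω ∩ {e | o ∉ e} ∈
            {ξ : BondConfig (Fin n) | (A.filter fun z => ξ ∈ openConn x z).card ≤ j}} := by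
        intro x; ext ω; simp only [mem_setOf_eq, filter_avoid_eq]
      have hle : (prodBernoulli fun e => if e ∈ {e : Sym2 (Fin n) | o ∉ e} then w e else 0).real
            {ξ : BondConfig (Fin n) | (A.filter fun z => ξ ∈ openConn y z).card ≤ j} ≤
          (prodBernoulli fun e => if e ∈ {e : Sym2 (Fin n) | o ∉ e} then w e else 0).real
            {ξ : BondConfig (Fin n) | (A.filter fun z => ξ ∈ openConn q z).card ≤ j} := by
        have h := hy
        simp only [hsW] at h
        rw [e1 y, e1 q, measureReal_preimage_avoid, measureReal_preimage_avoid] at h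
        exact h
      have key := observerSet_le_of_lonelier (fun e => if e ∈ {e : Sym2 (Fin n) | o ∉ e} then w e else 0)
        A B y q hyB j hle
      have e2 : {ω : BondConfig (Fin n) |
            (∀ y ∈ B, ¬ (openGraph (ω ∩ {e | o ∉ e})).Reachable q y) ∧
              1 ≤ (A.filter fun z => ∃ y ∈ B, (openGraph (ω ∩ {e | o ∉ e})).Reachable y z).card ∧
              (A.filter fun z => ∃ y ∈ B, (openGraph (ω ∩ {e | o ∉ e})).Reachable y z).card ≤ j} =
          {ω : BondConfig (Fin n) | ω ∩ {e | o ∉ e} ∈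
            {ξ : BondConfig (Fin n) | (∀ x ∈ B, ξ ∉ openConn q x) ∧
              1 ≤ (A.filter fun z => ∃ x ∈ B, ξ ∈ openConn x z).card ∧
              (A.filter fun z => ∃ x ∈ B, ξ ∈ openConn x z).card ≤ j}} := by
        ext ω; simp only [mem_setOf_eq, filter_avoid_exists_eq]; exact Iff.rfl
      have e3 : {ω : BondConfig (Fin n) |
            (∀ y ∈ B, ¬ (openGraph (ω ∩ {e | o ∉ e})).Reachable q y) ∧
              (A.filter fun z => (openGraph (ω ∩ {e | o ∉ e})).Reachable q z).card ≤ j} =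
          {ω : BondConfig (Fin n) | ω ∩ {e | o ∉ e} ∈
            {ξ : BondConfig (Fin n) | (∀ x ∈ B, ξ ∉ openConn q x) ∧
              (A.filter fun z => ξ ∈ openConn q z).card ≤ j}} := by
        ext ω; simp only [mem_setOf_eq, filter_avoid_eq]; exact Iff.rfl
      rw [e2, e3, measureReal_preimage_avoid, measureReal_preimage_avoid]
      convert key using 12
    · -- all members light: hypothesis `hCS`
      push Not at hheavy
      exact hCS B hBne fun y hy => ⟨hBo y hy, (Finset.mem_filter.1 (hBΓ hy)).2.2, hheavy y hy⟩

open CutObserver in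
/-- **One light Steiner neighbour: CIL at `v` in `G − o` transfers to CIL at `o` in `G` (given witness).**
Let `o ∉ A`, `q ∈ A`, and let `v` be a vertex such that every OTHER positive-weight neighbour `y ≠ o` of `o`
satisfies `s(y) ≤ s(q)` (relays no lighter than `q` and heavy Steiner vertices; `s` = `H`-lightness as in
`cil_of_starStability`).  If `μ{1 ≤ |π'(v)| ≤ j} ≤ μ{|π'(q)| ≤ j}` — CIL_j for the
observer `v` in the graph without the edges at `o`, with the witness `q` — then `μ{1 ≤ N ≤ j} ≤ μ{|π(q)| ≤ j}`.
The only light star is `{v}`, for which set-champion stability is CIL at `v` by the two-cluster identity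
`{q ~' v} ∩ {1 ≤ |π'(v)| ≤ j} = {q ~' v} ∩ {|π'(q)| ≤ j}` (`q ∈ A`).  Cumulative-isolation analogue of
Kozma–Nitzan's Theorem 5. [cite: KozmaNitzan2024, Thm. 5 (p. 13–14) — analogue for relay counts] -/
theorem cil_of_oneLightSteinerNeighbour (w : Sym2 (Fin n) → unitInterval) (A : Finset (Fin n))
    (o q v : Fin n) (j : ℕ) (hoA : o ∉ A) (hqA : q ∈ A)
    (hothers : ∀ y, y ≠ o → y ≠ v → w s(o, y) ≠ 0 →
      (prodBernoulli w).real {ω : BondConfig (Fin n) |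
          (A.filter fun z => (openGraph (ω ∩ {e | o ∉ e})).Reachable y z).card ≤ j} ≤
        (prodBernoulli w).real {ω : BondConfig (Fin n) |
          (A.filter fun z => (openGraph (ω ∩ {e | o ∉ e})).Reachable q z).card ≤ j})
    (hv : (prodBernoulli w).real {ω : BondConfig (Fin n) |
          1 ≤ (A.filter fun z => (openGraph (ω ∩ {e | o ∉ e})).Reachable v z).card ∧
            (A.filter fun z => (openGraph (ω ∩ {e | o ∉ e})).Reachable v z).card ≤ j} ≤
        (prodBernoulli w).real {ω : BondConfig (Fin n) |
          (A.filter fun z => (openGraph (ω ∩ {e | o ∉ e})).Reachable q z).card ≤ j}) :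
    (prodBernoulli w).real {ω : BondConfig (Fin n) |
        1 ≤ (A.filter fun x => ω ∈ openConn o x).card ∧ (A.filter fun x => ω ∈ openConn o x).card ≤ j} ≤
      (prodBernoulli w).real {ω : BondConfig (Fin n) | (A.filter fun x => ω ∈ openConn q x).card ≤ j} := by
  haveI : IsProbabilityMeasure (prodBernoulli w) := inferInstance
  set μ := prodBernoulli w with hμ
  have hqo : q ≠ o := fun h => hoA (h ▸ hqA)
  set R' : BondConfig (Fin n) → Fin n → Fin n → Prop := fun ω x y =>
    (openGraph (ω ∩ {e | o ∉ e})).Reachable x y with hR'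
  set sW : Fin n → ℝ := fun y => μ.real {ω : BondConfig (Fin n) |
    (A.filter fun z => R' ω y z).card ≤ j} with hsW
  refine cil_of_starStability w A o q j hoA hqo fun B hBne hlight => ?_
  -- a light star consists of `v` only
  have hBv : ∀ y ∈ B, y = v := by
    intro y hy
    obtain ⟨hyo, hwy, hlt⟩ := hlight y hy
    by_contra hyv
    exact absurd (hothers y hyo hyv hwy) (not_le.2 hlt)
  have hB : B = {v} := by
    obtain ⟨y, hy⟩ := hBne
    have := hBv y hy; subst this
    exact Finset.eq_singleton_iff_unique_mem.2 ⟨hy, hBv⟩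
  subst hB
  -- the two-cluster identity: on `{q ~' v}` both events coincide
  set Lv := {ω : BondConfig (Fin n) | 1 ≤ (A.filter fun z => R' ω v z).card ∧
    (A.filter fun z => R' ω v z).card ≤ j} with hLv
  set Rq' := {ω : BondConfig (Fin n) | (A.filter fun z => R' ω q z).card ≤ j} with hRq'
  set D := {ω : BondConfig (Fin n) | ¬ R' ω q v} with hD
  have hsame : ∀ ω, R' ω q v → ((A.filter fun z => R' ω v z) = (A.filter fun z => R' ω q z)) := by
    intro ω h
    exact Finset.filter_congr fun z _ => ⟨fun hz => h.trans hz, fun hz => h.symm.trans hz⟩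
  have hon : Lv ∩ Dᶜ = Rq' ∩ Dᶜ := by
    ext ω
    simp only [hLv, hRq', hD, mem_inter_iff, mem_setOf_eq, mem_compl_iff, not_not]
    constructor
    · rintro ⟨⟨_, h2⟩, hqv⟩
      rw [hsame ω hqv] at h2
      exact ⟨h2, hqv⟩
    · rintro ⟨h2, hqv⟩
      refine ⟨⟨?_, ?_⟩, hqv⟩
      · rw [hsame ω hqv]
        exact Finset.card_pos.2 ⟨q, Finset.mem_filter.2 ⟨hqA, SimpleGraph.Reachable.refl _⟩⟩
      · rw [hsame ω hqv]; exact h2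
  have hsplitL := measureReal_inter_add_sdiff (μ := μ) (s := Lv) (MeasurableSet.of_discrete (s := Dᶜ))
    (measure_ne_top _ _)
  have hsplitR := measureReal_inter_add_sdiff (μ := μ) (s := Rq') (MeasurableSet.of_discrete (s := Dᶜ))
    (measure_ne_top _ _)
  have hdiffL : Lv \ Dᶜ = {ω : BondConfig (Fin n) | (∀ y ∈ ({v} : Finset (Fin n)), ¬ R' ω q y) ∧
      1 ≤ (A.filter fun z => ∃ y ∈ ({v} : Finset (Fin n)), R' ω y z).card ∧
      (A.filter fun z => ∃ y ∈ ({v} : Finset (Fin n)), R' ω y z).card ≤ j} := by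
    ext ω
    simp only [hLv, hD, mem_sdiff, mem_setOf_eq, mem_compl_iff, not_not, Finset.mem_singleton, forall_eq,
      exists_eq_left]
    tauto
  have hdiffR : Rq' \ Dᶜ = {ω : BondConfig (Fin n) | (∀ y ∈ ({v} : Finset (Fin n)), ¬ R' ω q y) ∧
      (A.filter fun z => R' ω q z).card ≤ j} := by
    ext ω
    simp only [hRq', hD, mem_sdiff, mem_setOf_eq, mem_compl_iff, not_not, Finset.mem_singleton, forall_eq]
    tauto
  have hv' : μ.real Lv ≤ μ.real Rq' := hv
  show μ.real {ω : BondConfig (Fin n) | (∀ y ∈ ({v} : Finset (Fin n)), ¬ R' ω q y) ∧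
      1 ≤ (A.filter fun z => ∃ y ∈ ({v} : Finset (Fin n)), R' ω y z).card ∧
      (A.filter fun z => ∃ y ∈ ({v} : Finset (Fin n)), R' ω y z).card ≤ j} ≤
    μ.real {ω : BondConfig (Fin n) | (∀ y ∈ ({v} : Finset (Fin n)), ¬ R' ω q y) ∧
      (A.filter fun z => R' ω q z).card ≤ j}
  rw [← hdiffL, ← hdiffR]
  rw [hon] at hsplitL
  linarith

open CutObserver in
/-- **CIL_j for an observer with at most one light Steiner neighbour (cumulative-isolation analogue of
Kozma–Nitzan's Theorem 5).**  Let `A ≠ ∅`, `o ∉ A`, and let `v` be a vertex.  Suppose that, in the graph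
without the edges at `o` (`~'`, `π'`), (i) every positive-weight neighbour `y ≠ o, v` of `o` that is not a relay
is HEAVY: `μ{|π'(y)| ≤ j} ≤ μ{|π'(a)| ≤ j}` for some relay `a`, and (ii) CIL_j holds for the observer `v`:
`μ{1 ≤ |π'(v)| ≤ j} ≤ μ{|π'(a)| ≤ j}` for some relay `a`.  Then CIL_j holds at `o`:
`∃ a ∈ A, μ{1 ≤ N ≤ j} ≤ μ{|π(a)| ≤ j}` — the registered stub `stub_cumulativeIsolation` (crux
`NoHeavyLowerTail`, stmt-CriticalPhenomena-4575) on this class, for every `|A|` and every `j`.  Witness: a relay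
maximising `μ{|π'(·)| ≤ j}`.  (When `o` has no light non-relay neighbour at all, hypothesis (ii) is supplied
by any relay `v ∈ A`, recovering `Theorems.cil_relayNeighbours` / the heavy-Steiner theorem.)
[cite: KozmaNitzan2024, Thm. 5 (pp. 13–14) — analogue; VandenbergHaggstromKahn2005, Thm. 1.5] -/
theorem cumulativeIsolation_of_oneLightSteinerNeighbour (w : Sym2 (Fin n) → unitInterval)
    (A : Finset (Fin n)) (o v : Fin n) (j : ℕ) (hA : A.Nonempty) (hoA : o ∉ A)
    (hheavy : ∀ y, y ≠ o → y ≠ v → y ∉ A → w s(o, y) ≠ 0 → ∃ a ∈ A,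
      (prodBernoulli w).real {ω : BondConfig (Fin n) |
          (A.filter fun z => (openGraph (ω ∩ {e | o ∉ e})).Reachable y z).card ≤ j} ≤
        (prodBernoulli w).real {ω : BondConfig (Fin n) |
          (A.filter fun z => (openGraph (ω ∩ {e | o ∉ e})).Reachable a z).card ≤ j})
    (hCILv : ∃ a ∈ A,
      (prodBernoulli w).real {ω : BondConfig (Fin n) |
          1 ≤ (A.filter fun z => (openGraph (ω ∩ {e | o ∉ e})).Reachable v z).card ∧
            (A.filter fun z => (openGraph (ω ∩ {e | o ∉ e})).Reachable v z).card ≤ j} ≤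
        (prodBernoulli w).real {ω : BondConfig (Fin n) |
          (A.filter fun z => (openGraph (ω ∩ {e | o ∉ e})).Reachable a z).card ≤ j}) :
    ∃ a ∈ A,
      (prodBernoulli w).real {ω : BondConfig (Fin n) |
          1 ≤ (A.filter fun x => ω ∈ openConn o x).card ∧ (A.filter fun x => ω ∈ openConn o x).card ≤ j} ≤
        (prodBernoulli w).real {ω : BondConfig (Fin n) | (A.filter fun x => ω ∈ openConn a x).card ≤ j} := by
  set μ := prodBernoulli w with hμ
  set sW : Fin n → ℝ := fun y => μ.real {ω : BondConfig (Fin n) |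
    (A.filter fun z => (openGraph (ω ∩ {e | o ∉ e})).Reachable y z).card ≤ j} with hsW
  obtain ⟨q, hqA, hqmax⟩ := Finset.exists_max_image A sW hA
  refine ⟨q, hqA, cil_of_oneLightSteinerNeighbour w A o q v j hoA hqA ?_ ?_⟩
  · intro y hyo hyv hwy
    by_cases hyA : y ∈ A
    · exact hqmax y hyA
    · obtain ⟨a, ha, hle⟩ := hheavy y hyo hyv hyA hwy
      exact hle.trans (hqmax a ha)
  · obtain ⟨a, ha, hle⟩ := hCILv
    exact hle.trans (hqmax a ha)

end Summit.CriticalPhenomena.PercolationContinuityZ3.Theorems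

end
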